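import Mathlib
import Summits.KontsevichZagierPeriods.Zeta5Search.ThirdOrderAggregate
import HarnessLib

/-!
# ζ(5) search — THEOREM A⁗′ (THEOREM A⁗ with PALINDROMIC second-layer classes): the DROPPED pair and the aggregation

Cell `pub-zeta5` (HONEST FRAMING: systematic search; no irrationality claim unless certified), track «DENOM-LAW», seat `denom-prover-d1`
gen 10 (ATTEMPT-10).  `p`-adic valuations of the cell's OWN explicit rationals (class pieces of the Brown–Zudilin partial-fraction data);
nothing here is a statement about ζ(5); no γ of record moves; records in print UNMOVED.

WHAT IS NEW.  The tree's THEOREM A⁗ (`SecondOrder.LawA4`, PROVED: `lawA4_holds`) asks, in the frame `(M, T)` (`M ≥ 6` even, `T` a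
palindrome), that every pole class `z` with `ν_z = −M + 2` have a type list that is an ADMISSIBLE DOUBLE RAISE of `T` (hypothesis (T3) /
`H5`); such a pair `{z, z̄}` contributes `p²c ĝ_z·τ(T) (mod p³)` (`double_pair₃`).  A second kind of class is equally harmless at that
layer: a class `z` whose OWN type list is a PALINDROME.  Its exponent `−M + 2` is even, so it is not self-conjugate
(`selfConjugateOdd_holds`), its conjugate carries the same (reversed = equal) type, hence the same first digits
(`CellKit.hat_conj_of_pal`: `ŵ_z̄ = ŵ_z`, `v̂_z̄ = v̂_z`), while the units satisfy `ĝ_z̄ ≡ −ĝ_z (mod p)` (`gHat_pair_even_first`):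
the pair contributes `p²(ĝ_z + ĝ_z̄)σ_z ≡ 0 (mod p³)` — the «dropped pair» of the Lemma-D bonus, two layers up (`dropped_pair₃`).
Hence the aggregation of THEOREM A⁗ (`aggregate₄`) goes through verbatim under the WEAKER hypothesis
(T3′) «every pole class with `ν = −M + 2` has a type list that is an admissible double raise of `T` OR a palindrome» (`pair₃P`,
`aggregate₄P`); the transport to `b + e_j` and the valuation statement `v_p(Cas_j(b)) ≥ 7 − 2M` are in `DenomLaw/LawA4Pal.lean`.

WHY IT MATTERS (exact censuses of this seat, HOME `denom-law/prover-d1/g10/`): in the per-prime census of RULE R1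
(`DenomLaw.RuleR1Casoratian`, ⌊d/p⌋ = 1) on ALL 3,706 octave-1 configurations at `p = 11`, every landed rung (M/J/B/Y/O/X/I/U/E/CR/P) is
one short on exactly 33 cells (digit types a=2 N=12, a=6 N=16; deep layer EMPTY, the odd-centre class alone at `−M+1`, one conjugate pair
of single sextuple poles `(0,−6,0)` at `−M+2`); A⁗′ reaches all 33 (and fires on 49 R1 cells not reached by A⁗, 0 violations), and on
the exhaustive small cells (`b₀ ≤ 16`, every window prime, every admissible `j`) A⁗′ ∖ A⁗ has 0 violations (tight on the majority).
-/

noncomputable section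

open Finset PowerSeries

namespace Summit.KontsevichZagierPeriods.Zeta5Search.SecondOrder

open Summit.KontsevichZagierPeriods.Zeta5Search.DualSeries (InBox)
open Summit.KontsevichZagierPeriods.Zeta5Search.WedgeDictionary (coeffW coeffV)
open Summit.KontsevichZagierPeriods.Zeta5Search.CasoratianValuation (InPolytope)
open Summit.KontsevichZagierPeriods.Zeta5Search.ClusterValuation
open Summit.KontsevichZagierPeriods.Zeta5Search.PadicSeries
open Summit.KontsevichZagierPeriods.Zeta5Search.CellA (classW coeffW_eq_sum_classW padicNorm_p padicNorm_pow_eq gHat_conj)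
open Summit.KontsevichZagierPeriods.Zeta5Search.BigPrime (padicNorm_mul_le_one)
open Summit.KontsevichZagierPeriods.Zeta5Search.CellKit (conj_level)

variable {p : ℕ} [hp : Fact p.Prime]

/-! ## §1 The DROPPED pair at relative order `p²` -/

section Dropped

variable (b : ℕ → ℤ) (hb : InPolytope b) (hp5 : 5 ≤ p) (hpn : (p : ℤ) ≤ b 0) (hwin : (b 0 + 2 : ℤ) < (p : ℤ) ^ 2)
  (T : List ℤ) {z : ℕ} (hz : z < p) (hpole : 1 ≤ classPoleCount b p z)
  {m : ℤ} (hme : Even m) (hE : classExp b p z = m + 2)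
include hb hp5 hpn hwin hz hpole hme hE

/-- **P2′ — the DROPPED PAIR to relative order `p²`.**  A pole class `z` of even exponent `m + 2 ≤ −2` whose type list is a PALINDROME,
together with its conjugate `z̄`: `(Ω,N)_z + (Ω,N)_z̄ ≡ 0 (mod p³)` (stated with the scalar `a = 0` in the shape of `double_pair₃`). -/
theorem dropped_pair₃ (hpal : (classTypeList b p z).reverse = classTypeList b p z) :
    ∃ a : ℚ, (padicNorm p (a * typeTauW (tTop T) (tList T)) ≤ (p : ℚ) ^ (-(1 : ℤ)) ∧
        padicNorm p (a * typeTauV (tTop T) (tList T)) ≤ (p : ℚ) ^ (-(1 : ℤ))) ∧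
      padicNorm p (classW b p z / (-(p : ℚ)) ^ (m + 3) + classW b p (conjClass b p z) / (-(p : ℚ)) ^ (m + 3)
        - a * typeTauW (tTop T) (tList T)) ≤ (p : ℚ) ^ (-(3 : ℤ)) ∧
      padicNorm p (classV b p z / (-(p : ℚ)) ^ m + classV b p (conjClass b p z) / (-(p : ℚ)) ^ m
        - a * typeTauV (tTop T) (tList T)) ≤ (p : ℚ) ^ (-(3 : ℤ)) := by
  have h0 : 0 ≤ b 0 := hb.1.1
  have hp0 : (p : ℚ) ≠ 0 := Nat.cast_ne_zero.2 hp.out.ne_zero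
  have hp2 : p ≠ 2 := by omega
  obtain ⟨-, -, -, hn⟩ := thmA_data b hb hwin
  have hzn := le_b0_of_lt b hpn hz
  obtain ⟨hL, hL'⟩ := level_bounds' (p := p) b hzn
  have hEc : classExp b p (conjClass b p z) = m + 2 := by rw [classExp_conj b h0 hzn]; exact hE
  have hpolec : 1 ≤ classPoleCount b p (conjClass b p z) := by rw [classPoleCount_conj b h0 hzn]; exact hpole
  obtain ⟨hz', -, -⟩ := conj_level b hz hL hL'
  have heven : Even (classExp b p z) := by rw [hE]; exact hme.add (by decide : Even (2 : ℤ))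
  -- the class is not self-conjugate (its exponent is even)
  have hcz : ¬ CentreIn b p z := fun hcen =>
    (Int.not_odd_iff_even.2 heven) (selfConjugateOdd_holds b p z hb hp.out hp5 hz hpole hcen)
  -- first digits of both classes
  have hWz := subsub3W_norm b hb hp5 hwin hz hpole hE
  have hWc := subsub3W_norm b hb hp5 hwin hz' hpolec hEc
  have hVz := subsub3V_norm b hb hp5 hwin hz hpole hE
  have hVc := subsub3V_norm b hb hp5 hwin hz' hpolec hEc
  -- the palindromic type: the conjugate class has the SAME first digits
  have hpal' : ∀ k ≤ topLevel b p z, netExp b (z + (topLevel b p z - k) * p) = netExp b (z + k * p) :=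
    pal_of_reverse hL hL' hpal
  obtain ⟨hw, hv⟩ := CellKit.hat_conj_of_pal b hz hL hL' hb _ (fun k _ => rfl) hpal' hcz
  have hgg := gHat_pair_even_first b hb hp5 hz hL hL' hcz heven
  have hw1 : ∀ x, padicNorm p (wHat b p x) ≤ 1 := fun x => LevelClass.padicNorm_wHat_le_one b h0 hn hp2 x
  have hv1 : ∀ x, padicNorm p (vHat b p x) ≤ 1 := fun x =>
    (LevelClass.padicNorm_vHat_le_one b h0 hn hp2 : padicNorm p (vHat b p x) ≤ 1)
  -- the common final step: `Wz + Wc ≡ p²(ĝ_z + ĝ_z̄)s ≡ 0 (mod p³)`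
  have final : ∀ {Wz Wc s sc : ℚ}, padicNorm p (Wz - (p : ℚ) ^ 2 * (gHat b p z * s)) ≤ (p : ℚ) ^ (-(3 : ℤ)) →
      padicNorm p (Wc - (p : ℚ) ^ 2 * (gHat b p (conjClass b p z) * sc)) ≤ (p : ℚ) ^ (-(3 : ℤ)) →
      padicNorm p sc ≤ 1 → s - sc = 0 →
      padicNorm p (Wz + Wc - 0) ≤ (p : ℚ) ^ (-(3 : ℤ)) := by
    intro Wz Wc s sc h1 h2 hsc hst
    have e : Wz + Wc - 0 = (Wz - (p : ℚ) ^ 2 * (gHat b p z * s))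
        + (Wc - (p : ℚ) ^ 2 * (gHat b p (conjClass b p z) * sc))
        + (p : ℚ) ^ 2 * ((gHat b p (conjClass b p z) + gHat b p z) * sc + gHat b p z * (s - sc)) := by ring
    rw [e, hst, mul_zero, add_zero]
    refine (padicNorm.nonarchimedean (p := p)).trans (max_le ((padicNorm.nonarchimedean (p := p)).trans (max_le h1 h2)) ?_)
    exact (padicNorm_p_pow_mul_le 2 (padicNorm_mul_le_left hgg hsc)).trans (le_of_eq (by rw [← zpow_add₀ hp0]; norm_num))
  refine ⟨0, ⟨by rw [zero_mul, padicNorm.zero]; exact zpow_p_nonneg _,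
    by rw [zero_mul, padicNorm.zero]; exact zpow_p_nonneg _⟩, ?_, ?_⟩
  · rw [zero_mul]; exact final hWz hWc (hw1 _) (sub_eq_zero.2 hw.symm)
  · rw [zero_mul]; exact final hVz hVc (hv1 _) (sub_eq_zero.2 hv.symm)

end Dropped

/-! ## §2 Aggregation under (T3′) -/

section Agg

variable (b : ℕ → ℤ) (hb : InPolytope b) (hp5 : 5 ≤ p) (hpn : (p : ℤ) ≤ b 0) (hwin : (b 0 + 2 : ℤ) < (p : ℤ) ^ 2)
  (M : ℕ) (hM : 6 ≤ M) (hMe : Even M) (T : List ℤ) (hT : T.reverse = T)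
  (H1 : ∀ x ∈ multipoleClasses b p, -(M : ℤ) ≤ classExp b p x)
  (H2 : ∀ y, y < p → classPoleCount b p y = 1 → -(M : ℤ) + 1 ≤ classNu b p y)
  (H3 : ∀ x ∈ multipoleClasses b p, classExp b p x = -(M : ℤ) → ¬ CentreIn b p x ∧ classTypeList b p x = T)
  (H4 : ∀ y, y < p → 1 ≤ classPoleCount b p y → classNu b p y = -(M : ℤ) + 1 →
    isRaise T (classTypeList b p y) = true ∨ (¬ (2 : ℤ) ∣ b 0 ∧ CentreIn b p y ∧ classTypeList b p y = T))
  (H5P : ∀ z, z < p → 1 ≤ classPoleCount b p z → classNu b p z = -(M : ℤ) + 2 →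
    isRaise2 T (classTypeList b p z) = true ∨ (classTypeList b p z).reverse = classTypeList b p z)
include hb hp5 hpn hwin hM hMe hT H1 H2 H3 H4 H5P

/-- **Every residue and its conjugate contribute a multiple of `τ(T)` (mod p³)** under (T3′) (the proof of `pair₃` verbatim, with the
second-layer case split into `double_pair₃` / `dropped_pair₃`). -/
private theorem pair₃P {x : ℕ} (hx : x < p) : ∃ a : ℚ, (padicNorm p (a * typeTauW (tTop T) (tList T)) ≤ (p : ℚ) ^ (-(1 : ℤ)) ∧
      padicNorm p (a * typeTauV (tTop T) (tList T)) ≤ (p : ℚ) ^ (-(1 : ℤ))) ∧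
    padicNorm p (classW b p x / (-(p : ℚ)) ^ (-(M : ℤ) + 3) + classW b p (conjClass b p x) / (-(p : ℚ)) ^ (-(M : ℤ) + 3)
      - a * typeTauW (tTop T) (tList T)) ≤ (p : ℚ) ^ (-(3 : ℤ)) ∧
    padicNorm p (classV b p x / (-(p : ℚ)) ^ (-(M : ℤ)) + classV b p (conjClass b p x) / (-(p : ℚ)) ^ (-(M : ℤ))
      - a * typeTauV (tTop T) (tList T)) ≤ (p : ℚ) ^ (-(3 : ℤ)) := by
  have h0 : 0 ≤ b 0 := hb.1.1
  have hp0 : 0 < p := hp.out.pos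
  have hpQ : (p : ℚ) ≠ 0 := Nat.cast_ne_zero.2 hp.out.ne_zero
  have hp2 : p ≠ 2 := by omega
  have hpn' : p ≤ (b 0).toNat := by omega
  have hme : Even (-(M : ℤ)) := ((Int.even_coe_nat M).2 hMe).neg
  have hxn := le_b0_of_lt b hpn hx
  have hx' : conjClass b p x < p := conjClass_lt b hp0 x
  have hcc : conjClass b p (conjClass b p x) = x := conjClass_conjClass b hx hpn'
  have hEc : classExp b p (conjClass b p x) = classExp b p x := classExp_conj b h0 hxn
  have hPc : classPoleCount b p (conjClass b p x) = classPoleCount b p x := classPoleCount_conj b h0 hxn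
  -- `ν = m+1` or `ν = m+2` forces `ν = E`
  have hνE : ∀ {y : ℕ} {k : ℤ}, k < 0 → classNu b p y = k → classExp b p y = k := by
    intro y k hk hν
    by_contra hne
    have := (tame_of_classNu_ne b (by rw [hν]; exact Ne.symm hne)).2; omega
  -- the second layer, either order of the pair
  have layer2 : ∀ {z : ℕ}, z < p → 1 ≤ classPoleCount b p z → classNu b p z = -(M : ℤ) + 2 →
      ∃ a : ℚ, (padicNorm p (a * typeTauW (tTop T) (tList T)) ≤ (p : ℚ) ^ (-(1 : ℤ)) ∧
          padicNorm p (a * typeTauV (tTop T) (tList T)) ≤ (p : ℚ) ^ (-(1 : ℤ))) ∧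
        padicNorm p (classW b p z / (-(p : ℚ)) ^ (-(M : ℤ) + 3) + classW b p (conjClass b p z) / (-(p : ℚ)) ^ (-(M : ℤ) + 3)
          - a * typeTauW (tTop T) (tList T)) ≤ (p : ℚ) ^ (-(3 : ℤ)) ∧
        padicNorm p (classV b p z / (-(p : ℚ)) ^ (-(M : ℤ)) + classV b p (conjClass b p z) / (-(p : ℚ)) ^ (-(M : ℤ))
          - a * typeTauV (tTop T) (tList T)) ≤ (p : ℚ) ^ (-(3 : ℤ)) := by
    intro z hz h1 hν
    have hE : classExp b p z = -(M : ℤ) + 2 := hνE (by omega) hν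
    rcases H5P z hz h1 hν with hr | hpal
    · exact double_pair₃ b hb hp5 hpn hwin hT hz h1 hme hE (by omega) hr
    · exact dropped_pair₃ b hb hp5 hpn hwin T hz h1 hme hE hpal
  by_cases hD : 2 ≤ classPoleCount b p x ∧ classExp b p x = -(M : ℤ)
  · -- deep pair
    obtain ⟨h2, hE⟩ := hD
    obtain ⟨hc, htl⟩ := H3 x (mem_filter.2 ⟨mem_range.2 hx, h2⟩) hE
    have hpal : (classTypeList b p x).reverse = classTypeList b p x := by rw [htl]; exact hT
    have heven : Even (classExp b p x) := by rw [hE]; exact hme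
    have hodd : Odd (3 + classExp b p x) := by
      rw [hE]; obtain ⟨r, hr⟩ := hMe; exact ⟨1 - (r : ℤ), by omega⟩
    obtain ⟨-, htw, htv, -⟩ := deep_data b hb hpn hT hx hc htl hodd
    obtain ⟨hW, hV⟩ := deep_pair₃ b hb hp5 hpn hwin hx (by omega) hc hpal heven (by omega)
    rw [hE, htw] at hW
    rw [hE, htv] at hV
    have hg1 : padicNorm p (gHat b p x) ≤ 1 := padicNorm_gHat_le_one' b hp5 x
    have ha : padicNorm p (-((p : ℚ) * gHat b p x * (phiHat b p x - (p : ℚ) * (topLevel b p x : ℚ) * curvHat b p x))) ≤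
        (p : ℚ) ^ (-(1 : ℤ)) := by
      rw [padicNorm.neg, padicNorm.mul, padicNorm.mul, padicNorm_p]
      have hin : padicNorm p (phiHat b p x - (p : ℚ) * (topLevel b p x : ℚ) * curvHat b p x) ≤ 1 :=
        (padicNorm.sub (p := p)).trans (max_le (padicNorm_phiHat_le_one b hp2 x)
          (padicNorm_mul_le_one (padicNorm_mul_le_one padicNorm_p_le_one
            (by simpa using padicNorm.of_nat (p := p) (topLevel b p x))) (padicNorm_curvHat_le_one b hp2 x)))
      calc (p : ℚ) ^ (-(1 : ℤ)) * padicNorm p (gHat b p x) * _ ≤ (p : ℚ) ^ (-(1 : ℤ)) * 1 * 1 :=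
            mul_le_mul (mul_le_mul_of_nonneg_left hg1 (zpow_p_nonneg _)) hin (padicNorm.nonneg _)
              (mul_nonneg (zpow_p_nonneg _) zero_le_one)
        _ = (p : ℚ) ^ (-(1 : ℤ)) := by ring
    obtain ⟨-, -, -, hn⟩ := thmA_data b hb hwin
    have hL1 : padicNorm p (topLevel b p x : ℚ) ≤ 1 := by simpa using padicNorm.of_nat (p := p) (topLevel b p x)
    have htauW : padicNorm p (tauW b p x) ≤ 1 := by
      unfold tauW
      exact (padicNorm.sub (p := p)).trans (max_le (padicNorm_mul_le_one (by rw [padicNorm_two hp2])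
        (padicNorm_wHat2_le_one b h0 hn hp2 x)) (padicNorm_mul_le_one hL1 (LevelClass.padicNorm_wHat_le_one b h0 hn hp2 x)))
    have htauV : padicNorm p (tauV b p x) ≤ 1 := by
      unfold tauV
      exact (padicNorm.sub (p := p)).trans (max_le (padicNorm_mul_le_one (by rw [padicNorm_two hp2])
        (padicNorm_vHat2_le_one b h0 hn hp2 x)) (padicNorm_mul_le_one hL1 (LevelClass.padicNorm_vHat_le_one b h0 hn hp2)))
    refine ⟨-((p : ℚ) * gHat b p x * (phiHat b p x - (p : ℚ) * (topLevel b p x : ℚ) * curvHat b p x)), ⟨?_, ?_⟩, ?_, ?_⟩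
    · rw [← htw]; exact padicNorm_mul_le_left ha htauW
    · rw [← htv]; exact padicNorm_mul_le_left ha htauV
    · have e : classW b p x / (-(p : ℚ)) ^ (-(M : ℤ) + 3) + classW b p (conjClass b p x) / (-(p : ℚ)) ^ (-(M : ℤ) + 3)
          - -((p : ℚ) * gHat b p x * (phiHat b p x - (p : ℚ) * (topLevel b p x : ℚ) * curvHat b p x))
            * typeTauW (tTop T) (tList T) =
          classW b p x / (-(p : ℚ)) ^ (-(M : ℤ) + 3) + classW b p (conjClass b p x) / (-(p : ℚ)) ^ (-(M : ℤ) + 3)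
          + (p : ℚ) * gHat b p x * (phiHat b p x - (p : ℚ) * (topLevel b p x : ℚ) * curvHat b p x)
            * typeTauW (tTop T) (tList T) := by ring
      rw [e]; exact hW
    · have e : classV b p x / (-(p : ℚ)) ^ (-(M : ℤ)) + classV b p (conjClass b p x) / (-(p : ℚ)) ^ (-(M : ℤ))
          - -((p : ℚ) * gHat b p x * (phiHat b p x - (p : ℚ) * (topLevel b p x : ℚ) * curvHat b p x))
            * typeTauV (tTop T) (tList T) =
          classV b p x / (-(p : ℚ)) ^ (-(M : ℤ)) + classV b p (conjClass b p x) / (-(p : ℚ)) ^ (-(M : ℤ))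
          + (p : ℚ) * gHat b p x * (phiHat b p x - (p : ℚ) * (topLevel b p x : ℚ) * curvHat b p x)
            * typeTauV (tTop T) (tList T) := by ring
      rw [e]; exact hV
  by_cases hS : 1 ≤ classPoleCount b p x ∧ classNu b p x = -(M : ℤ) + 1
  · obtain ⟨h1, hν⟩ := hS
    have hE : classExp b p x = -(M : ℤ) + 1 := hνE (by omega) hν
    exact raise_pair₃ b hb hp5 hpn hwin hT hx h1 hme hE (by omega) (H4 x hx h1 hν)
  by_cases hSc : 1 ≤ classPoleCount b p (conjClass b p x) ∧ classNu b p (conjClass b p x) = -(M : ℤ) + 1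
  · obtain ⟨h1, hν⟩ := hSc
    have hE : classExp b p (conjClass b p x) = -(M : ℤ) + 1 := hνE (by omega) hν
    obtain ⟨a, ha, hW, hV⟩ := raise_pair₃ b hb hp5 hpn hwin hT hx' h1 hme hE (by omega) (H4 _ hx' h1 hν)
    rw [hcc] at hW hV
    refine ⟨a, ha, ?_, ?_⟩
    · rw [add_comm (classW b p x / _)]; exact hW
    · rw [add_comm (classV b p x / _)]; exact hV
  by_cases hS2 : 1 ≤ classPoleCount b p x ∧ classNu b p x = -(M : ℤ) + 2
  · exact layer2 hx hS2.1 hS2.2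
  by_cases hS2c : 1 ≤ classPoleCount b p (conjClass b p x) ∧ classNu b p (conjClass b p x) = -(M : ℤ) + 2
  · obtain ⟨a, ha, hW, hV⟩ := layer2 hx' hS2c.1 hS2c.2
    rw [hcc] at hW hV
    refine ⟨a, ha, ?_, ?_⟩
    · rw [add_comm (classW b p x / _)]; exact hW
    · rw [add_comm (classV b p x / _)]; exact hV
  · -- both `x` and `x̄` are negligible
    have hDc : ¬ (2 ≤ classPoleCount b p (conjClass b p x) ∧ classExp b p (conjClass b p x) = -(M : ℤ)) := by
      rw [hPc, hEc]; exact hD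
    obtain ⟨hWx, hVx⟩ := negl₃ b hb hp5 hwin hM H1 H2 hx hD hS hS2
    obtain ⟨hWc, hVc⟩ := negl₃ b hb hp5 hwin hM H1 H2 hx' hDc hSc hS2c
    refine ⟨0, ⟨by rw [zero_mul, padicNorm.zero]; exact zpow_p_nonneg _,
      by rw [zero_mul, padicNorm.zero]; exact zpow_p_nonneg _⟩, ?_, ?_⟩
    · rw [zero_mul, sub_zero]
      exact (padicNorm.nonarchimedean (p := p)).trans (max_le hWx hWc)
    · rw [zero_mul, sub_zero]
      exact (padicNorm.nonarchimedean (p := p)).trans (max_le hVx hVc)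

/-- **AGGREGATION under (T3′).**  `2·W/(−p)^{m+3} ≡ A τ_W(T)`, `2·V/(−p)^m ≡ A τ_V(T) (mod p³)`, ONE scalar `A`, `‖A‖ ≤ p⁻¹`. -/
theorem aggregate₄P : ∃ A : ℚ,
    padicNorm p (2 * (coeffW b / (-(p : ℚ)) ^ (-(M : ℤ) + 3)) - A * typeTauW (tTop T) (tList T)) ≤ (p : ℚ) ^ (-(3 : ℤ)) ∧
    padicNorm p (2 * (coeffV b / (-(p : ℚ)) ^ (-(M : ℤ))) - A * typeTauV (tTop T) (tList T)) ≤ (p : ℚ) ^ (-(3 : ℤ)) ∧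
    padicNorm p (A * typeTauW (tTop T) (tList T)) ≤ (p : ℚ) ^ (-(1 : ℤ)) ∧
    padicNorm p (A * typeTauV (tTop T) (tList T)) ≤ (p : ℚ) ^ (-(1 : ℤ)) := by
  have hp0 : 0 < p := hp.out.pos
  have hpn' : p ≤ (b 0).toNat := by have := hb.1.1; omega
  have hpair : ∀ x ∈ range p, ∃ a : ℚ, (padicNorm p (a * typeTauW (tTop T) (tList T)) ≤ (p : ℚ) ^ (-(1 : ℤ)) ∧
      padicNorm p (a * typeTauV (tTop T) (tList T)) ≤ (p : ℚ) ^ (-(1 : ℤ))) ∧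
      padicNorm p (classW b p x / (-(p : ℚ)) ^ (-(M : ℤ) + 3) + classW b p (conjClass b p x) / (-(p : ℚ)) ^ (-(M : ℤ) + 3)
        - a * typeTauW (tTop T) (tList T)) ≤ (p : ℚ) ^ (-(3 : ℤ)) ∧
      padicNorm p (classV b p x / (-(p : ℚ)) ^ (-(M : ℤ)) + classV b p (conjClass b p x) / (-(p : ℚ)) ^ (-(M : ℤ))
        - a * typeTauV (tTop T) (tList T)) ≤ (p : ℚ) ^ (-(3 : ℤ)) :=
    fun x hx => pair₃P b hb hp5 hpn hwin M hM hMe T hT H1 H2 H3 H4 H5P (mem_range.1 hx)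
  choose! a ha using hpair
  have hconj : ∀ y ∈ range p, conjClass b p y ∈ range p := fun y _ => mem_range.2 (conjClass_lt b hp0 y)
  refine ⟨∑ x ∈ range p, a x, ?_, ?_, ?_, ?_⟩
  rotate_left 2
  · rw [sum_mul]; exact padicNorm.sum_le' (fun x hx => (ha x hx).1.1) (zpow_p_nonneg _)
  · rw [sum_mul]; exact padicNorm.sum_le' (fun x hx => (ha x hx).1.2) (zpow_p_nonneg _)
  · have e : 2 * (coeffW b / (-(p : ℚ)) ^ (-(M : ℤ) + 3)) - (∑ x ∈ range p, a x) * typeTauW (tTop T) (tList T) =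
        ∑ x ∈ range p, (classW b p x / (-(p : ℚ)) ^ (-(M : ℤ) + 3)
          + classW b p (conjClass b p x) / (-(p : ℚ)) ^ (-(M : ℤ) + 3) - a x * typeTauW (tTop T) (tList T)) := by
      rw [sum_sub_distrib, sum_mul, coeffW_eq_sum_classW b hp0, sum_div,
        ← sum_conj_symm b hpn' (range p) (fun y hy => mem_range.1 hy) hconj]
    rw [e]
    exact padicNorm.sum_le' (fun x hx => (ha x hx).2.1) (zpow_p_nonneg _)
  · have e : 2 * (coeffV b / (-(p : ℚ)) ^ (-(M : ℤ))) - (∑ x ∈ range p, a x) * typeTauV (tTop T) (tList T) =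
        ∑ x ∈ range p, (classV b p x / (-(p : ℚ)) ^ (-(M : ℤ))
          + classV b p (conjClass b p x) / (-(p : ℚ)) ^ (-(M : ℤ)) - a x * typeTauV (tTop T) (tList T)) := by
      rw [sum_sub_distrib, sum_mul, coeffV_eq_sum_classV b hp0, sum_div,
        ← sum_conj_symm b hpn' (range p) (fun y hy => mem_range.1 hy) hconj]
    rw [e]
    exact padicNorm.sum_le' (fun x hx => (ha x hx).2.2) (zpow_p_nonneg _)

end Agg

end Summit.KontsevichZagierPeriods.Zeta5Search.SecondOrder

end
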